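import Literature.AlgebraicGeometry.GroupSchemes.BTGroupNilpotentPoints
import Mathlib.RingTheory.AdicCompletion.Algebra
import HarnessLib

/-!
# The layers of a Barsotti–Tate group with `𝒪`-action are `𝒪⁄pⁿ`-modules: endomorphisms from `p`-adically compatible families

Topic `Literature/AlgebraicGeometry/GroupSchemes`; namespace `Literature.AlgebraicGeometry.GroupSchemes.IsRingActionBT`.  Cell `hodgecm-mathlib`
(D-0151), FLOOR 0, P6 «MOD programme» (crux hLiu418 = stmt-HodgeConjecture-24832), generic organ **(O-BTcong)** (self-proposed to the K∕BT desk
2026-09-01T15:18Z) serving the HEART-field formula «`𝒢_y := Fix(ε_w)` on `𝒜_y[p^∞]`, `ε_w` the idempotent of `𝒪_F ⊗ ℤ_p` at `w`» (F0P6a-plan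
14:56Z; ★ `BTGroup.Hom.fixBTGroup`, ★ `BarsottiTateGroupFixedPartMap`): the idempotent `e_w` is NOT an element of `𝒪_F`, so the endomorphism `ε_w`
of the Barsotti–Tate group must be assembled LAYERWISE from elements `a_n ∈ 𝒪` with `a_{n+1} ≡ a_n (mod pⁿ)` — legitimate because `[pⁿ] = 0` on
`G_n`, so the action of `𝒪` on the `n`-th layer factors through `𝒪⁄pⁿ`.  THEOREMS + four `def`s (`homOfCompatibleFamily`, `repr`, `liftAt`, `completedAction`); no
named fact, no instance, no notation, no `sorry`.  HC_CM is proved only modulo the printed citations until rung 0 closes; nothing here is about HC.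

THE PRINT.  [Tate1967] §2, (2.1)–(2.2): `G_ν` is killed by `p^ν`; homomorphisms of `p`-divisible groups are compatible families of layer maps,
and `Hom(G, H)` is a `ℤ_p`-module («`p`-divisible groups form a `ℤ_p`-linear category»: an endomorphism of `G` is a compatible family of
endomorphisms of the `G_ν`, each a `ℤ⁄p^ν`-linear object); [RapoportSmithlingZhang2020Diagonal] §4.1 (p. 17) «(dec pdiv)»: the idempotents of
`O_F ⊗ ℤ_p = ∏_{w∣p} O_{F,w}` decompose `A[p^∞] = ∏_w A[w^∞]`.

* §1 (`hβ : IsRingActionBT B β`) `app_mul_pow_eq_one` («`β(c·pⁿ) = 0` on `G_n`», ★ `app_natCast` + `killed`), `app_eq_one_of_mem_span_pow`,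
  **`app_eq_app_of_sub_mem_span_pow`** («`a ≡ b (mod pⁿ) ⇒ β a = β b` on `G_n`»), `app_comm` (`β a` and `β b` commute layerwise).
* §2 **`homOfCompatibleFamily hβ a ha : BTGroup.Hom B B`** for `a : ℕ → 𝒪` with `a (n+1) − a n ∈ (pⁿ)` (layers `(β (a n))_n`); `_app`,
  `homOfCompatibleFamily_congr` (congruent families give the same endomorphism), `homOfCompatibleFamily_const` (`= β c` for the constant family),
  `comp_homOfCompatibleFamily_comm` (commutes with every `β b`), **`homOfCompatibleFamily_idem`** (`a_n² ≡ a_n (mod pⁿ)` ⇒ idempotent, the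
  hypothesis shape of ★ `fixBTGroup`), `homOfCompatibleFamily_mul` (products of families ↦ composites).
* §3 **`completedAction hβ I hI : AdicCompletion I 𝒪 → BTGroup.Hom B B`** for an ideal `I ≤ (p)` (Mathlib `AdicCompletion`; layers read through
  `AdicCompletion.evalₐ I n` via a Cauchy representative `repr`∕`liftAt`), `completedAction_app`, **`completedAction_of`** (`= β a` on `𝒪`), `completedAction_congr_app`, and
  **`isRingActionBT_completedAction`** — the completed ring `𝒪̂_I` (e.g. `𝒪_F ⊗ ℤ_p = (𝒪_F)^_{(p)}`) ACTS, so its idempotents split `B` by ★ `fixBTGroup`.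

## References
* [Tate1967] J. T. Tate, *p-divisible groups* (Driebergen 1966), Springer 1967 — §2, (2.1)–(2.2).
* [RapoportSmithlingZhang2020Diagonal] M. Rapoport, B. Smithling, W. Zhang, Compos. Math. 156 (2020) — §4.1 (p. 17), «(dec pdiv)».
-/

noncomputable section

universe u v

open CategoryTheory CategoryTheory.Limits AlgebraicGeometry MonoidalCategory CartesianMonoidalCategory
open scoped MonObj

namespace Literature.AlgebraicGeometry.GroupSchemes

namespace IsRingActionBT

variable {A : Type u} [CommRing A] {p H : ℕ} {B : BTGroup (Spec (.of A)) p H} {𝒪 : Type v} [CommRing 𝒪] {β : 𝒪 → BTGroup.Hom B B}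

/-! ## §1 The action on the `n`-th layer factors through `𝒪 ⁄ pⁿ` -/

/-- **`β(c · pⁿ)` is trivial on `G_n`**: `β(pⁿ) = [pⁿ]` (★ `app_natCast`) and `[pⁿ] = 0` on `G_n` (`killed`). [cite: Tate1967, §2 (2.1)] -/
theorem app_mul_pow_eq_one (hβ : IsRingActionBT B β) (c : 𝒪) (n : ℕ) :
    letI := B.grpObj n; (β (c * (p : 𝒪) ^ n)).app n = 1 := by
  letI := B.grpObj n
  haveI := (β c).isMonHom_app n
  rw [hβ.map_mul, BTGroup.Hom.comp_app, ← Nat.cast_pow, hβ.app_natCast, B.killed n]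
  exact MonObj.one_comp _

/-- `a ∈ (pⁿ) ⇒ β a` is trivial on `G_n`. [cite: Tate1967, §2 (2.1)] -/
theorem app_eq_one_of_mem_span_pow (hβ : IsRingActionBT B β) {a : 𝒪} {n : ℕ} (ha : a ∈ Ideal.span {(p : 𝒪) ^ n}) :
    letI := B.grpObj n; (β a).app n = 1 := by
  obtain ⟨c, rfl⟩ := Ideal.mem_span_singleton'.mp ha
  exact hβ.app_mul_pow_eq_one c n

/-- **`a ≡ b (mod pⁿ) ⇒ β a = β b` on the `n`-th layer**: the `𝒪`-action on `G_n` factors through `𝒪 ⁄ pⁿ`. [cite: Tate1967, §2 (2.1)] -/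
theorem app_eq_app_of_sub_mem_span_pow (hβ : IsRingActionBT B β) {a b : 𝒪} {n : ℕ} (hab : a - b ∈ Ideal.span {(p : 𝒪) ^ n}) :
    (β a).app n = (β b).app n := by
  letI := B.grpObj n
  have h : β a = β ((a - b) + b) := by rw [sub_add_cancel]
  rw [h, hβ.app_add', hβ.app_eq_one_of_mem_span_pow hab, one_mul]

/-- `β a` and `β b` commute (layerwise), `𝒪` being commutative. [cite: Tate1967, §2 (2.1)] -/
theorem app_comm (hβ : IsRingActionBT B β) (a b : 𝒪) (n : ℕ) :
    (β a).app n ≫ (β b).app n = (β b).app n ≫ (β a).app n := by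
  rw [← BTGroup.Hom.comp_app, ← BTGroup.Hom.comp_app, ← hβ.map_mul, ← hβ.map_mul, mul_comm]

/-! ## §2 Endomorphisms from `p`-adically compatible families -/

/-- **THE ENDOMORPHISM DEFINED BY A `p`-ADICALLY COMPATIBLE FAMILY** `a : ℕ → 𝒪`, `a (n+1) ≡ a n (mod pⁿ)`: layers `β (a n)` on `G_n`;
compatible with the transitions because `β (a (n+1))` and `β (a n)` agree on `G_n` (§1).  (For `𝒪 = 𝒪_F` and `a_n ≡ e_w (mod pⁿ)` chosen
by the Chinese remainder theorem this is the idempotent `ε_w` cutting out `A[w^∞]`.) [cite: Tate1967, §2 (2.1)]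
[cite: RapoportSmithlingZhang2020Diagonal, §4.1 (p. 17)] -/
def homOfCompatibleFamily (hβ : IsRingActionBT B β) (a : ℕ → 𝒪) (ha : ∀ n, a (n + 1) - a n ∈ Ideal.span {(p : 𝒪) ^ n}) :
    BTGroup.Hom B B where
  app n := (β (a n)).app n
  isMonHom_app n := (β (a n)).isMonHom_app n
  incl_comp_app n := by
    rw [← hβ.app_eq_app_of_sub_mem_span_pow (ha n)]
    exact (β (a (n + 1))).incl_comp_app n

/-- Unfolding: the `n`-th layer of the family endomorphism is `β (a n)` on `G_n`. [cite: Tate1967, §2 (2.1)] -/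
@[simp] theorem homOfCompatibleFamily_app (hβ : IsRingActionBT B β) (a : ℕ → 𝒪) (ha : ∀ n, a (n + 1) - a n ∈ Ideal.span {(p : 𝒪) ^ n})
    (n : ℕ) : (hβ.homOfCompatibleFamily a ha).app n = (β (a n)).app n := rfl

/-- Congruent families (`a n ≡ a' n (mod pⁿ)` for all `n`) define the SAME endomorphism. [cite: Tate1967, §2 (2.1)] -/
theorem homOfCompatibleFamily_congr (hβ : IsRingActionBT B β) {a a' : ℕ → 𝒪} (ha : ∀ n, a (n + 1) - a n ∈ Ideal.span {(p : 𝒪) ^ n})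
    (ha' : ∀ n, a' (n + 1) - a' n ∈ Ideal.span {(p : 𝒪) ^ n}) (h : ∀ n, a n - a' n ∈ Ideal.span {(p : 𝒪) ^ n}) :
    hβ.homOfCompatibleFamily a ha = hβ.homOfCompatibleFamily a' ha' :=
  BTGroup.Hom.ext fun n => hβ.app_eq_app_of_sub_mem_span_pow (h n)

/-- The constant family `a n = c` gives back `β c`. [cite: Tate1967, §2 (2.1)] -/
theorem homOfCompatibleFamily_const (hβ : IsRingActionBT B β) (c : 𝒪) :
    hβ.homOfCompatibleFamily (fun _ => c) (fun n => by rw [sub_self]; exact Ideal.zero_mem _) = β c :=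
  BTGroup.Hom.ext fun _ => rfl

/-- The family endomorphism COMMUTES with every `β b`. [cite: Tate1967, §2 (2.1)] -/
theorem comp_homOfCompatibleFamily_comm (hβ : IsRingActionBT B β) (a : ℕ → 𝒪)
    (ha : ∀ n, a (n + 1) - a n ∈ Ideal.span {(p : 𝒪) ^ n}) (b : 𝒪) :
    (β b).comp (hβ.homOfCompatibleFamily a ha) = (hβ.homOfCompatibleFamily a ha).comp (β b) :=
  BTGroup.Hom.ext fun n => by
    rw [BTGroup.Hom.comp_app, BTGroup.Hom.comp_app, homOfCompatibleFamily_app]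
    exact hβ.app_comm b (a n) n

/-- Products of compatible families give composites: the family `a n * a' n` defines `(ε_{a}) ≫ (ε_{a'})`… precisely
`homOfCompatibleFamily (a * a') = (homOfCompatibleFamily a').comp (homOfCompatibleFamily a)` (★ `map_mul` is diagrammatic).
[cite: Tate1967, §2 (2.1)] -/
theorem homOfCompatibleFamily_mul (hβ : IsRingActionBT B β) {a a' : ℕ → 𝒪} (ha : ∀ n, a (n + 1) - a n ∈ Ideal.span {(p : 𝒪) ^ n})
    (ha' : ∀ n, a' (n + 1) - a' n ∈ Ideal.span {(p : 𝒪) ^ n})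
    (haa' : ∀ n, (a * a') (n + 1) - (a * a') n ∈ Ideal.span {(p : 𝒪) ^ n}) :
    hβ.homOfCompatibleFamily (a * a') haa' = (hβ.homOfCompatibleFamily a' ha').comp (hβ.homOfCompatibleFamily a ha) :=
  BTGroup.Hom.ext fun n => by
    rw [BTGroup.Hom.comp_app, homOfCompatibleFamily_app, homOfCompatibleFamily_app, homOfCompatibleFamily_app, Pi.mul_apply,
      hβ.map_mul, BTGroup.Hom.comp_app]

/-- The product of two compatible families is compatible (so `homOfCompatibleFamily_mul` applies). [cite: Tate1967, §2 (2.1)] -/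
theorem compatible_mul {a a' : ℕ → 𝒪} (ha : ∀ n, a (n + 1) - a n ∈ Ideal.span {(p : 𝒪) ^ n})
    (ha' : ∀ n, a' (n + 1) - a' n ∈ Ideal.span {(p : 𝒪) ^ n}) (n : ℕ) :
    (a * a') (n + 1) - (a * a') n ∈ Ideal.span {(p : 𝒪) ^ n} := by
  have h : (a * a') (n + 1) - (a * a') n = a (n + 1) * (a' (n + 1) - a' n) + (a (n + 1) - a n) * a' n := by
    simp only [Pi.mul_apply]; ring
  rw [h]
  exact Ideal.add_mem _ (Ideal.mul_mem_left _ _ (ha' n)) (Ideal.mul_mem_right _ _ (ha n))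

/-- **IDEMPOTENCY CRITERION**: if `a_n² ≡ a_n (mod pⁿ)` for all `n`, the family endomorphism `ε` satisfies `ε_n ≫ ε_n = ε_n` on every
layer — the hypothesis shape `hε` of ★ `BTGroup.Hom.fixBTGroup`. [cite: RapoportSmithlingZhang2020Diagonal, §4.1 (p. 17)] [cite: Tate1967, §2 (2.1)] -/
theorem homOfCompatibleFamily_idem (hβ : IsRingActionBT B β) (a : ℕ → 𝒪) (ha : ∀ n, a (n + 1) - a n ∈ Ideal.span {(p : 𝒪) ^ n})
    (hidem : ∀ n, a n * a n - a n ∈ Ideal.span {(p : 𝒪) ^ n}) (n : ℕ) :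
    (hβ.homOfCompatibleFamily a ha).app n ≫ (hβ.homOfCompatibleFamily a ha).app n = (hβ.homOfCompatibleFamily a ha).app n := by
  rw [homOfCompatibleFamily_app, ← BTGroup.Hom.comp_app, ← hβ.map_mul]
  exact hβ.app_eq_app_of_sub_mem_span_pow (hidem n)

/-! ## §3 The completed action `𝒪̂_I → End B` for `I ≤ (p)` -/

section Completion

variable (I : Ideal 𝒪)

/-- A chosen Cauchy representative of `x ∈ 𝒪̂_I` (Mathlib `AdicCompletion.mk_surjective`). [cite: Tate1967, §2 (2.1)] -/
def repr (x : AdicCompletion I 𝒪) : AdicCompletion.AdicCauchySequence I 𝒪 :=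
  (AdicCompletion.mk_surjective I 𝒪 x).choose

/-- The chosen representative represents `x`. [cite: Tate1967, §2 (2.1)] -/
theorem mk_repr (x : AdicCompletion I 𝒪) : AdicCompletion.mk I 𝒪 (repr I x) = x :=
  (AdicCompletion.mk_surjective I 𝒪 x).choose_spec

/-- The `n`-th term of the chosen representative: a lift to `𝒪` of the `n`-th component of `x`. [cite: Tate1967, §2 (2.1)] -/
def liftAt (n : ℕ) (x : AdicCompletion I 𝒪) : 𝒪 :=
  (repr I x).val n

/-- The lift reduces to the `n`-th component (`AdicCompletion.evalₐ I n x : 𝒪 ⧸ Iⁿ`). [cite: Tate1967, §2 (2.1)] -/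
theorem mk_liftAt (n : ℕ) (x : AdicCompletion I 𝒪) : Ideal.Quotient.mk (I ^ n) (liftAt I n x) = AdicCompletion.evalₐ I n x := by
  conv_rhs => rw [← mk_repr I x]
  exact (AdicCompletion.evalₐ_mk I n (repr I x)).symm

/-- The terms of the representative are compatible: `liftAt (n+1) x ≡ liftAt n x (mod Iⁿ)`. [cite: Tate1967, §2 (2.1)] -/
theorem liftAt_succ_sub_liftAt_mem (n : ℕ) (x : AdicCompletion I 𝒪) : liftAt I (n + 1) x - liftAt I n x ∈ I ^ n := by
  rw [← Ideal.Quotient.eq]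
  exact AdicCompletion.Ideal.mk_eq_mk (I := I) (hmn := Nat.le_succ n) (r := repr I x)

variable {I}

/-- If `I ≤ (p)`, then `Iⁿ ≤ (pⁿ)`. [cite: Tate1967, §2 (2.1)] -/
theorem pow_le_span_pow (hI : I ≤ Ideal.span {(p : 𝒪)}) (n : ℕ) : I ^ n ≤ Ideal.span {(p : 𝒪) ^ n} := by
  rw [← Ideal.span_singleton_pow]
  exact Ideal.pow_right_mono hI n

/-- **THE COMPLETED ACTION `𝒪̂_I → End B`** for an ideal `I ≤ (p)`: `x ↦` the endomorphism of the compatible family of lifts of the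
components of `x` (§2).  For `𝒪 = 𝒪_F`, `I = (p)`: the ring `𝒪_F ⊗ ℤ_p ≅ ∏_{w∣p} 𝒪_{F,w}` acts on `A[p^∞]`, and its idempotents `e_w` give
the `w`-parts `A[w^∞] = Fix(ε_w)` (★ `fixBTGroup`). [cite: Tate1967, §2 (2.1)] [cite: RapoportSmithlingZhang2020Diagonal, §4.1 (p. 17)] -/
def completedAction (hβ : IsRingActionBT B β) (hI : I ≤ Ideal.span {(p : 𝒪)}) (x : AdicCompletion I 𝒪) : BTGroup.Hom B B :=
  hβ.homOfCompatibleFamily (fun n => liftAt I n x) fun n => pow_le_span_pow hI n (liftAt_succ_sub_liftAt_mem I n x)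

/-- Unfolding: the `n`-th layer of `completedAction x` is `β` of the chosen lift of `x mod Iⁿ`. [cite: Tate1967, §2 (2.1)] -/
theorem completedAction_app (hβ : IsRingActionBT B β) (hI : I ≤ Ideal.span {(p : 𝒪)}) (x : AdicCompletion I 𝒪) (n : ℕ) :
    (hβ.completedAction hI x).app n = (β (liftAt I n x)).app n := rfl

/-- **The `n`-th layer of `completedAction x` is `β a` for ANY `a ≡ x (mod Iⁿ)`** (independence of the lift). [cite: Tate1967, §2 (2.1)] -/
theorem completedAction_app_eq (hβ : IsRingActionBT B β) (hI : I ≤ Ideal.span {(p : 𝒪)}) (x : AdicCompletion I 𝒪) (n : ℕ) (a : 𝒪)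
    (ha : Ideal.Quotient.mk (I ^ n) a = AdicCompletion.evalₐ I n x) : (hβ.completedAction hI x).app n = (β a).app n := by
  rw [completedAction_app]
  refine hβ.app_eq_app_of_sub_mem_span_pow (pow_le_span_pow hI n ?_)
  rw [← Ideal.Quotient.eq, mk_liftAt, ha]

/-- **`completedAction (of a) = β a`**: the completed action extends `β`. [cite: Tate1967, §2 (2.1)] -/
theorem completedAction_of (hβ : IsRingActionBT B β) (hI : I ≤ Ideal.span {(p : 𝒪)}) (a : 𝒪) :
    hβ.completedAction hI (AdicCompletion.of I 𝒪 a) = β a :=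
  BTGroup.Hom.ext fun n => hβ.completedAction_app_eq hI _ n a (AdicCompletion.evalₐ_of I n a).symm

/-- `completedAction 1 = id`. [cite: Tate1967, §2 (2.1)] -/
theorem completedAction_one (hβ : IsRingActionBT B β) (hI : I ≤ Ideal.span {(p : 𝒪)}) :
    hβ.completedAction hI 1 = BTGroup.Hom.id B := by
  rw [← hβ.map_one]
  exact BTGroup.Hom.ext fun n => hβ.completedAction_app_eq hI 1 n 1 (by rw [_root_.map_one, _root_.map_one])

/-- `completedAction (x * y) = completedAction y ∘ completedAction x` (diagrammatic `comp`, as in ★ `IsRingActionBT.map_mul`).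
[cite: Tate1967, §2 (2.1)] -/
theorem completedAction_mul (hβ : IsRingActionBT B β) (hI : I ≤ Ideal.span {(p : 𝒪)}) (x y : AdicCompletion I 𝒪) :
    hβ.completedAction hI (x * y) = (hβ.completedAction hI y).comp (hβ.completedAction hI x) := by
  refine BTGroup.Hom.ext fun n => ?_
  simp only [BTGroup.Hom.comp_app, completedAction_app]
  rw [← BTGroup.Hom.comp_app, ← hβ.map_mul]
  refine hβ.completedAction_app_eq hI _ n _ ?_
  rw [_root_.map_mul, mk_liftAt, mk_liftAt, _root_.map_mul]

/-- `completedAction (x + y) = completedAction x + completedAction y` layerwise (sum in the group `End(G_n)`).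
[cite: Tate1967, §2 (2.1)] -/
theorem completedAction_add_app (hβ : IsRingActionBT B β) (hI : I ≤ Ideal.span {(p : 𝒪)}) (x y : AdicCompletion I 𝒪) (n : ℕ) :
    letI := B.grpObj n
    (hβ.completedAction hI (x + y)).app n = (hβ.completedAction hI x).app n * (hβ.completedAction hI y).app n := by
  letI := B.grpObj n
  simp only [completedAction_app]
  rw [← hβ.app_add']
  refine hβ.completedAction_app_eq hI _ n _ ?_
  rw [_root_.map_add, mk_liftAt, mk_liftAt, _root_.map_add]

/-- **THE COMPLETED ACTION IS A RING ACTION** (`IsRingActionBT`): `𝒪̂_I` acts on `B`, extending `β`. [cite: Tate1967, §2 (2.1)]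
[cite: RapoportSmithlingZhang2020Diagonal, §4.1 (p. 17)] -/
theorem isRingActionBT_completedAction (hβ : IsRingActionBT B β) (hI : I ≤ Ideal.span {(p : 𝒪)}) :
    IsRingActionBT B (hβ.completedAction hI) := by
  refine ⟨hβ.completedAction_one hI, hβ.completedAction_mul hI, fun x y n => ?_⟩
  letI := B.grpObj n
  exact hβ.completedAction_add_app hI x y n

/-- Two elements of `𝒪̂_I` with the same `n`-th component act identically on `G_n`. [cite: Tate1967, §2 (2.1)] -/
theorem completedAction_congr_app (hβ : IsRingActionBT B β) (hI : I ≤ Ideal.span {(p : 𝒪)}) {x y : AdicCompletion I 𝒪} {n : ℕ}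
    (h : AdicCompletion.evalₐ I n x = AdicCompletion.evalₐ I n y) :
    (hβ.completedAction hI x).app n = (hβ.completedAction hI y).app n :=
  hβ.completedAction_app_eq hI x n _ ((mk_liftAt I n y).trans h.symm)

/-- **An idempotent of `𝒪̂_I` acts by an idempotent endomorphism** (layerwise `ε ≫ ε = ε`, the hypothesis of ★ `fixBTGroup`).
[cite: RapoportSmithlingZhang2020Diagonal, §4.1 (p. 17)] -/
theorem completedAction_idem (hβ : IsRingActionBT B β) (hI : I ≤ Ideal.span {(p : 𝒪)}) {e : AdicCompletion I 𝒪} (he : e * e = e) (n : ℕ) :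
    (hβ.completedAction hI e).app n ≫ (hβ.completedAction hI e).app n = (hβ.completedAction hI e).app n := by
  rw [← BTGroup.Hom.comp_app, ← hβ.completedAction_mul hI, he]

/-- The completed action commutes with `β`: `β b ≫ x̂ = x̂ ≫ β b` layerwise. [cite: Tate1967, §2 (2.1)] -/
theorem completedAction_comm_app (hβ : IsRingActionBT B β) (hI : I ≤ Ideal.span {(p : 𝒪)}) (x : AdicCompletion I 𝒪) (b : 𝒪) (n : ℕ) :
    (β b).app n ≫ (hβ.completedAction hI x).app n = (hβ.completedAction hI x).app n ≫ (β b).app n := by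
  rw [completedAction_app]
  exact hβ.app_comm b _ n

end Completion

end IsRingActionBT

end Literature.AlgebraicGeometry.GroupSchemes

end
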